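/-
Copyright (c) 2026 the pub-hodgecm-mathlib formalisation cell (harness21).  Prover seat hodgecm-mathlib-K2E1-p14 (g5), Track B ∕ K2-LIT, h413 = `stmt-HodgeConjecture-24833`,
R90-TF section S8 «ContSpec-n½», socket B MID :358, deal (V-τ) ED. 3 (S8-R299 (b) «ED. 2′ = bind `hCT`», dealer R90-CS-plan (g4)): the constant-term row (ii) of ★ p865451 (V-τ) ED. 2
(`D ψ φt hCT hfac hφt hg₀ hφtbd`) DISCHARGED from the witness's Ec-FREE UNFOLDING PROFILE `(Ag, M, hψ2, g₀)` — the road of ★ `scalPackage_of_inputs` ((R)′ OF RECORD) inlined at the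
(iii) scalar of record: ★ `differentiableOn_middleCoefficient_slitPlane_cm_three` on the repaired continuation + ★ `eventually_factorisation_of_unfolded`.
-/
import Summits.HodgeConjecture.HodgeConjecture.Theorems.R90S8ResGMidBlockNeBotOfTauGeneratorLettersV2U3   -- ★ p865451 (this seat): (V-τ) ED. 2 (`hMS_tauWitness_of_columnLetters`); brings ★ ED. 1 p865372 (`resGMidBlock_ne_bot_of_tauGenerator_rows`), ★ (R)′τ V3, ★ p865152
import HarnessLib

/-!
# S8 socket B MID — `R90S8ResGMidBlockNeBotOfTauGeneratorLettersV3U3` ((V-τ), ED. 3): ED. 2 with the CONSTANT-TERM ROW (ii) DISCHARGED from the witness's Ec-free unfolding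
# profile — visible instead `(Ag, hAg, M, hM, hψ2, g₀, hg₀)`

Track B ∕ K2-LIT, crux h413 = `stmt-HodgeConjecture-24833`, route of record `HCCMUnconditional`; cell `hodgecm-mathlib`, R90-TF programme, section S8 «ContSpec-n½», socket B MID :358
∕ (V), general sub-row (V-τ).  THEOREMS ONLY (no `def`, no `instance`, no `notation`, no named-fact hypothesis, no `sorry`; default heartbeats); lane `--supports stmt-HodgeConjecture-24833
--as helper` (count-neutral).  CLOSES NO SOCKET (letters ≠ payment).

THE DISCHARGE.  ★ p863385's row (ii) asks, on a punctured-neighbourhood domain `D` of `3∕2`, for the continued constant-term identity `(Ec z)_B = φ·H^z + ψ_z·H^{2−z}` with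
`ψ_z = qc(z)·φt_z` near `3∕2`, `φt` continuous at `3∕2`, bounded there, and NON-VANISHING at one point.  All of it follows — as in ★ `scalPackage_of_inputs` (the (R)′ road), but keeping
the (iii) scalar `qc` of record — from the Ec-FREE UNFOLDING PROFILE of the witness: translate amplitudes `Ag g` holomorphic on `{1 < Re}`, `‖Ag g (3∕2)‖ ≤ M`, the tube identity
`((E(φ_z))_B(g) − φ(g)H(g)^z)∕H(g)^{2−z} = Ag g z · c_S(z)` (`2 < Re z`, `c_S` = ★ F5's ratio over the (iii) sets `S, T′`), and a base point `g₀` with `Ag g₀ (3∕2) ≠ 0` (for the shifted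
pure tensor: ★ `hA32_shifted_of_record_at_basePoint_of_modEq`).  PROOF (§1 **`resGMidBlock_ne_bot_of_tauGenerator_rows_v2`**, Ec as binder): repair the export at its removable
candidates (★ ED. 1 §1 ∕ ★ R90-C133-p02 §1), so `ψ_z(g) := ((Ec♯ z)_B(g) − φ(g)H^z)∕H^{2−z}` is holomorphic on the slit plane (★ `differentiableOn_middleCoefficient_slitPlane_cm_three`);
on the tube `Ec♯ z = E(φ_z)`, so `hψ2` reads `ψ_z = Ag·c_S`; ★ `eventually_factorisation_of_unfolded` (identity theorem across `{1<Re} ∖ (Sp ∪ Pq)`, `q = A·c_S`, `A(3∕2) ≠ 0`) gives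
`ψ_z(g) = qc(z)·(Ag g z ∕ A z)` on a punctured neighbourhood of `3∕2`; `D :=` an open piece of it inside `{1<Re} ∩ Pᶜ ∖ {3∕2}`; `φt := Ag∕A` (continuous at `3∕2`, bound `M∕‖A(3∕2)‖`,
`φt(3∕2) g₀ ≠ 0`); then ★ ED. 1 `resGMidBlock_ne_bot_of_tauGenerator_rows`.  §2 HEAD **`resGMidBlock_ne_bot_of_tauGenerator_letters_v3`** = exports ★ (★ p865131 ∘ ★ p864934) + `hMS` ★
(★ ED. 2 §1) + §1: visible {`hPL`; the (iii) scalar block of record `q qc Pq … A hA hsrc hA32` (shared with (V-1), as in (R)′τ V3); the unfolding profile (ii′); MS frame extras; (R)′τ letters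
`hunfK hPreal hreal`}.
VISIBLE → PAYER: (ii′) ⇐ ★ p865072 `hunfK_pureTensor_of_readings` ∘ ★ p864998 §2 ∘ ★ p865311 (amplitudes on `K_max`) + Iwasawa transport to all `g` (the (V-1) column's ★
`rowTwo_of_coordRoad` pattern) + ★ `hA32_shifted_of_record_at_basePoint_of_modEq`; the rest as in ED. 2's table.
HONEST LABEL: HC_CM is proved only modulo the 7 printed citations (2 remaining named inputs: hLiu418 = `stmt-HodgeConjecture-24832`, h413 = `stmt-HodgeConjecture-24833`) until
rung 0 closes; (V-τ) ED. 3 = ★ ED. 2 with row (ii) ★-discharged MODULO the unfolding profile (ii′) — letters with named payers, not payments; :358 stays `sorry` in B; REL ≠ ★ ≠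
WRITTEN ≠ BUILT; count-neutral.

## References
* [MoeglinWaldspurger1995] C. Mœglin, J.-L. Waldspurger, *Spectral Decomposition and Eisenstein Series* (1995), II.1.7, IV.1.9–IV.1.11, V.3.13.
* [Langlands1976] R. P. Langlands, *On the Functional Equations Satisfied by Eisenstein Series*, LNM 544 (1976), §6–§7.
* [BernsteinLapid2019] J. Bernstein, E. Lapid, *On the meromorphic continuation of Eisenstein series*, J. Amer. Math. Soc. 37 (2024), Thm 2.3, §4.
* [Rogawski1990] J. D. Rogawski, *Automorphic Representations of Unitary Groups in Three Variables* (1990), §13.9 (ii) p. 229.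
* [Conway1978] J. B. Conway, *Functions of One Complex Variable* (2nd ed., 1978), V §1.
-/

set_option autoImplicit false
set_option linter.dupNamespace false  -- the mandated namespace `…HodgeConjecture.HodgeConjecture.R90.S8` (LEAD #1 L1) repeats the summit's segment

noncomputable section

open MeasureTheory Measure NumberField IsDedekindDomain Set Filter Topology Metric Function ContRepresentation
open scoped ENNReal NNReal MatrixGroups ComplexConjugate
open Literature.MeasureTheory.Group Literature.NumberTheory Literature.RepresentationTheory.CompactGroups
open Literature.NumberTheory.Automorphic Literature.NumberTheory.Automorphic.UnitaryGroup Literature.NumberTheory.LFunctions Literature.NumberTheory.GaloisRepresentations AdelicGroupData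
open Literature.NumberTheory.Automorphic.Arthur2013.Leaves.TECR Literature.NumberTheory.Rogawski1990
open Summit.HodgeConjecture.HodgeConjecture.Cruxes.H413.K2E1BorelEisensteinU
open Summit.HodgeConjecture.HodgeConjecture.Cruxes.H413.K2E1BLBorelSpacesU2Defs
open Summit.HodgeConjecture.HodgeConjecture.Cruxes.H413.K2E1BLBorelOperatorsU2Defs
open Summit.HodgeConjecture.HodgeConjecture.Cruxes.H413.K2E1CharacterEisensteinU2Defs
open Summit.HodgeConjecture.HodgeConjecture.Cruxes.H413.K2E1ChiSectionSpaceU2Defs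
open Summit.HodgeConjecture.HodgeConjecture.Cruxes.H413.K2E1CharacterEisensteinU3PairDefs
open Summit.HodgeConjecture.HodgeConjecture.Cruxes.H413.K2E1ChiSectionSpaceU3PairDefs
open Summit.HodgeConjecture.HodgeConjecture.Cruxes.H413.K2E1HeckeLHalfNeZeroDefs (LHalfNeZero)
open Summit.HodgeConjecture.HodgeConjecture.Cruxes.H413.K2E1ChiConstantTermHolomorphicCMThree (differentiableOn_middleCoefficient_slitPlane_cm_three)
open Summit.HodgeConjecture.HodgeConjecture.Cruxes.H413.K2E1ChiConstantTermFactorisationContinuedU3 (eventually_factorisation_of_unfolded)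

namespace Summit.HodgeConjecture.HodgeConjecture.R90.S8

variable (L : Type) [Field L] [NumberField L] [IsCMField L]
  [MeasurableSpace (quasiSplit (↥(maximalRealSubfield L)) L (IsCMField.complexConj L) 3).Adelic] [BorelSpace (quasiSplit (↥(maximalRealSubfield L)) L (IsCMField.complexConj L) 3).Adelic]
  [MeasurableSpace (arch (↥(maximalRealSubfield L)) L (IsCMField.complexConj L) 3 ((StdForm.antidiagonal 3).over L))] [BorelSpace (arch (↥(maximalRealSubfield L)) L (IsCMField.complexConj L) 3 ((StdForm.antidiagonal 3).over L))]
  [MeasurableSpace (finAdelic (↥(maximalRealSubfield L)) L (IsCMField.complexConj L) 3 ((StdForm.antidiagonal 3).over L))] [BorelSpace (finAdelic (↥(maximalRealSubfield L)) L (IsCMField.complexConj L) 3 ((StdForm.antidiagonal 3).over L))]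
  [MeasurableSpace (AdeleRing (𝓞 L) L)ˣ] [BorelSpace (AdeleRing (𝓞 L) L)ˣ]

/-! ## §1 The rows head with row (ii) from the unfolding profile -/

omit [MeasurableSpace (arch (↥(maximalRealSubfield L)) L (IsCMField.complexConj L) 3 ((StdForm.antidiagonal 3).over L))] [BorelSpace (arch (↥(maximalRealSubfield L)) L (IsCMField.complexConj L) 3 ((StdForm.antidiagonal 3).over L))]
  [MeasurableSpace (finAdelic (↥(maximalRealSubfield L)) L (IsCMField.complexConj L) 3 ((StdForm.antidiagonal 3).over L))] [BorelSpace (finAdelic (↥(maximalRealSubfield L)) L (IsCMField.complexConj L) 3 ((StdForm.antidiagonal 3).over L))]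
  [MeasurableSpace (AdeleRing (𝓞 L) L)ˣ] [BorelSpace (AdeleRing (𝓞 L) L)ˣ] in
/-- **§1 — `resGMidBlock_ne_bot_of_tauGenerator_rows_v2`**: ★ ED. 1 `resGMidBlock_ne_bot_of_tauGenerator_rows` with its row (ii) (`D ψ φt hE3 hfac hφt hg₀ hφtbd`) BUILT from the Ec-free
unfolding profile `(Ag, hAg, M, hM, hψ2, g₀, hg₀)` at the (iii) scalar of record (the module docstring's proof); (i′) in the export's shape (off `P`).
[cite: MoeglinWaldspurger1995, II.1.7, IV.1.11] [cite: Langlands1976, §7] [cite: Conway1978, V §1] -/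
theorem resGMidBlock_ne_bot_of_tauGenerator_rows_v2
    (μ : Measure (quasiSplit (↥(maximalRealSubfield L)) L (IsCMField.complexConj L) 3).automorphicQuotient) [(quasiSplit (↥(maximalRealSubfield L)) L (IsCMField.complexConj L) 3).IsAutomorphicMeasure μ]
    (μω : HeckeCharacter L) (hμu : μω.IsUnitary)
    (hμω : ∀ x : ideleGroup ↥(maximalRealSubfield L), μω (AdeleRing.ideleBaseChange (↥(maximalRealSubfield L)) L x) = quadraticHeckeCharCM L x)
    (ξ : OneDimAutRepH L)
    -- (i) THE τ-ADMISSIBLE WITNESS at the finite-only level `(K′ := ι_f U₀, ω := 1)` (★ D1 ∕ T1 conventions; no `K_∞`-equivariance imposed)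
    (U₀ : Subgroup ↥(finAdelic (↥(maximalRealSubfield L)) L (IsCMField.complexConj L) 3 ((StdForm.antidiagonal 3).over L)))
    (φ : (quasiSplit (↥(maximalRealSubfield L)) L (IsCMField.complexConj L) 3).Adelic → ℂ) (hφ : φ ∈ chiSectionSpacePair (ξ.bcη⁻¹ * ξ.bcψ⁻¹ * μω) ξ.ψ (tauLevel L U₀) ((1 : ↥(tauLevel L U₀) →* ℂ) : ↥(tauLevel L U₀) → ℂ)) (hφc : Continuous φ)
    -- (i) THE EXPORTED CONTINUATION in ★ p865131's NF-free shape (payer: ★ `hTEXP6_row_of_ports … hμu (hCO_of_transposeRealisations … hμu)` — see `resGMidBlock_ne_bot_of_tauGenerator_letters`)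
    (Ec : ℂ → (quasiSplit (↥(maximalRealSubfield L)) L (IsCMField.complexConj L) 3).Adelic → ℂ) (P : Set ℂ) (hPc : IsClosed P) (hPcd : ∀ z₀ : ℂ, ∀ᶠ s in 𝓝[≠] z₀, s ∉ P) (hPre : ∀ z ∈ P, z.re ≤ 2)
    (hEcE : ∀ z : ℂ, 2 < z.re → Ec z = eisensteinSeriesU (flatSectionU φ z)) (hEan : ∀ g (z : ℂ), z ∉ P → AnalyticAt ℂ (fun z => Ec z g) z)
    (hE4 : ∀ z : ℂ, z ∉ P → Continuous (Ec z))
    (hEbd : ∀ z₁ : ℂ, z₁ ∉ P → ∀ K : Set (quasiSplit (↥(maximalRealSubfield L)) L (IsCMField.complexConj L) 3).Adelic, IsCompact K → ∃ V ∈ 𝓝 z₁, ∃ M : ℝ, ∀ z ∈ V, ∀ g ∈ K, ‖Ec z g‖ ≤ M)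
    -- (i) THE POLE LEDGER (estate T's `hPL` bytes, ★ p863972's (B-P-K) ∕ (B-3∕2)): joint removability at the candidates of `{1 < Re} ∖ {3∕2}`, a simple pole at `3∕2`
    (hbddPK : ∀ z₀ ∈ P, 1 < z₀.re → z₀ ≠ ((3 : ℂ) / 2) → ∀ K : Set (quasiSplit (↥(maximalRealSubfield L)) L (IsCMField.complexConj L) 3).Adelic, IsCompact K → ∃ C : ℝ, ∀ᶠ z in 𝓝[≠] z₀, ∀ g ∈ K, ‖Ec z g‖ ≤ C)
    (hbdd32 : ∀ g, ∃ C : ℝ, ∀ᶠ z in 𝓝[≠] ((3 : ℂ) / 2), ‖(z - ((3 : ℂ) / 2)) * Ec z g‖ ≤ C)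
    -- the Heisenberg package of the constant term (any Haar `ν`, fundamental domain of compact closure)
    (ν : Measure ↥(adelicUnipotent (↥(maximalRealSubfield L)) L (IsCMField.complexConj L) 3)) [ν.IsHaarMeasure]
    {𝓕 : Set ↥(adelicUnipotent (↥(maximalRealSubfield L)) L (IsCMField.complexConj L) 3)}
    (h𝓕N : IsFundamentalDomain ↥(rationalUnipotent (↥(maximalRealSubfield L)) L (IsCMField.complexConj L) 3) 𝓕 ν) (h𝓕c : IsCompact (closure 𝓕))
    -- (iii) THE SCALAR BLOCK OF RECORD (shared with the (V-1) column, as in (R)′τ V3): the continued scalar `qc` off its co-discrete `Pq`, the F5 ramification sets and the base amplitude `A` with `q = A·c_S`, `A(3∕2) ≠ 0`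
    (q qc : ℂ → ℂ) {Pq : Set ℂ} (hqcq : ∀ z : ℂ, 2 < z.re → qc z = q z) (hPqcd : ∀ z₀ : ℂ, ∀ᶠ s in 𝓝[≠] z₀, s ∉ Pq) (hqa : ∀ z : ℂ, z ∉ Pq → AnalyticAt ℂ qc z)
    {S : Set (HeightOneSpectrum (𝓞 L))} {T' : Set (HeightOneSpectrum (𝓞 ↥(maximalRealSubfield L)))}
    (hS : S.Finite) (hurφ : ∀ w ∉ S, (ξ.bcη⁻¹ * μω).IsUnramifiedAt w) (hT' : T'.Finite) (hurη : ∀ v ∉ T', (1 : HeckeCharacter ↥(maximalRealSubfield L)).IsUnramifiedAt v)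
    (A : ℂ → ℂ) (hA : DifferentiableOn ℂ A {z : ℂ | 1 < z.re})
    (hsrc : ∀ z : ℂ, 2 < z.re → q z = A z *
          ((partialStandardL S (fun w => {(ξ.bcη⁻¹ * μω).valueAtUniformizer w}) (z - 1) * partialStandardL T' (fun v => {(1 : HeckeCharacter ↥(maximalRealSubfield L)).valueAtUniformizer v}) (2 * z - 2)) /
            (partialStandardL S (fun w => {(ξ.bcη⁻¹ * μω).valueAtUniformizer w}) z * partialStandardL T' (fun v => {(1 : HeckeCharacter ↥(maximalRealSubfield L)).valueAtUniformizer v}) (2 * z - 1))))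
    (hA32 : A (3 / 2) ≠ 0)
    -- (ii′) THE WITNESS'S Ec-FREE UNFOLDING PROFILE (payer for the shifted pure tensor: ★ p865072 ∘ ★ p864998 §2 ∘ ★ p865311 on `K_max` + Iwasawa transport; ★ `hA32_shifted_of_record_at_basePoint_of_modEq` for `hg₀`)
    (Ag : (quasiSplit (↥(maximalRealSubfield L)) L (IsCMField.complexConj L) 3).Adelic → ℂ → ℂ) (hAg : ∀ g, DifferentiableOn ℂ (Ag g) {z : ℂ | 1 < z.re}) {M : ℝ} (hM : ∀ g, ‖Ag g ((3 : ℂ) / 2)‖ ≤ M)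
    (hψ2 : ∀ z : ℂ, 2 < z.re → ∀ g : (quasiSplit (↥(maximalRealSubfield L)) L (IsCMField.complexConj L) 3).Adelic,
      (borelConstantTerm ν 𝓕 (eisensteinSeriesU (flatSectionU φ z)) g - φ g * (((borelHeight g : ℝ≥0) : ℝ) : ℂ) ^ z) / (((borelHeight g : ℝ≥0) : ℝ) : ℂ) ^ (2 - z) = Ag g z *
        ((partialStandardL S (fun w => {(ξ.bcη⁻¹ * μω).valueAtUniformizer w}) (z - 1) * partialStandardL T' (fun v => {(1 : HeckeCharacter ↥(maximalRealSubfield L)).valueAtUniformizer v}) (2 * z - 2)) /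
            (partialStandardL S (fun w => {(ξ.bcη⁻¹ * μω).valueAtUniformizer w}) z * partialStandardL T' (fun v => {(1 : HeckeCharacter ↥(maximalRealSubfield L)).valueAtUniformizer v}) (2 * z - 1))))
    {g₀ : (quasiSplit (↥(maximalRealSubfield L)) L (IsCMField.complexConj L) 3).Adelic} (hg₀ : Ag g₀ ((3 : ℂ) / 2) ≠ 0)
    -- (i′) the (E6) family of the export OFF `P` and the Maass–Selberg letter (★ ED. 2 §1 pays it)
    {T : ℝ≥0} (hT : 1 ≤ T) (Fam : ℂ → (quasiSplit (↥(maximalRealSubfield L)) L (IsCMField.complexConj L) 3).L2 μ) (hFd : DifferentiableOn ℂ Fam Pᶜ)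
    (hFam : ∀ z : ℂ, z ∉ P → ((Fam z : (quasiSplit (↥(maximalRealSubfield L)) L (IsCMField.complexConj L) 3).L2 μ) : (quasiSplit (↥(maximalRealSubfield L)) L (IsCMField.complexConj L) 3).automorphicQuotient → ℂ) =ᵐ[μ] (quasiSplit (↥(maximalRealSubfield L)) L (IsCMField.complexConj L) 3).quotFun (truncation ν 𝓕 T (Ec z)))
    (hMS : ∃ C : ℝ, ∀ᶠ z in 𝓝[≠] ((3 : ℂ) / 2), ‖(z - ((3 : ℂ) / 2)) • Fam z‖ ≤ C) :
    LHalfNeZero (ξ.bcη⁻¹ * μω) → resGMidBlock L μ ξ μω ≠ ⊥ := by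
  classical
  intro hL
  haveI : LocallyCompactSpace (quasiSplit (↥(maximalRealSubfield L)) L (IsCMField.complexConj L) 3).Adelic :=
    inferInstanceAs (LocallyCompactSpace (adelic (↥(maximalRealSubfield L)) L (IsCMField.complexConj L) 3 ((StdForm.antidiagonal 3).over L)))
  have hpow : ∀ (g : (quasiSplit (↥(maximalRealSubfield L)) L (IsCMField.complexConj L) 3).Adelic) (w : ℂ), ((((borelHeight g : ℝ≥0) : ℝ) : ℂ) : ℂ) ^ w ≠ 0 := fun g w => by
    rw [Ne, Complex.cpow_eq_zero_iff, not_and_or]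
    exact Or.inl (Complex.ofReal_ne_zero.2 (NNReal.coe_ne_zero.2 (borelHeight_pos g).ne'))
  -- the repaired continuation (★ ED. 1 §1 ∕ ★ R90-C133-p02 §1): slit-plane holomorphy, tube identity, layer-2 rows
  obtain ⟨E', hoff, hon⟩ : ∃ E' : ℂ → (quasiSplit (↥(maximalRealSubfield L)) L (IsCMField.complexConj L) 3).Adelic → ℂ,
      (∀ z g, ¬ (z ∈ P ∧ 1 < z.re ∧ z ≠ ((3 : ℂ) / 2)) → E' z g = Ec z g) ∧
      (∀ z g, z ∈ P → 1 < z.re → z ≠ ((3 : ℂ) / 2) → E' z g = limUnder (𝓝[≠] z) (fun w => Ec w g)) :=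
    ⟨fun z g => if z ∈ P ∧ 1 < z.re ∧ z ≠ ((3 : ℂ) / 2) then limUnder (𝓝[≠] z) (fun w => Ec w g) else Ec z g,
      fun z g h => if_neg h, fun z g h1 h2 h3 => if_pos ⟨h1, h2, h3⟩⟩
  have hbddP : ∀ g, ∀ z₀ ∈ P, 1 < z₀.re → z₀ ≠ ((3 : ℂ) / 2) → ∃ C : ℝ, ∀ᶠ z in 𝓝[≠] z₀, ‖Ec z g‖ ≤ C := fun g z₀ hz₀P hz₀ hz₀' => by
    obtain ⟨C, hC⟩ := hbddPK z₀ hz₀P hz₀ hz₀' {g} isCompact_singleton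
    exact ⟨C, hC.mono fun z hz => hz g rfl⟩
  have hEd := differentiableOn_slit_of_repaired Ec E' P hPc hPcd hEan hbddP hoff hon
  have hE2' : ∀ z : ℂ, 2 < z.re → E' z = eisensteinSeriesU (flatSectionU φ z) := repaired_eq_of_two_lt_re Ec E' P hPre hoff hEcE
  have hE4' := continuous_slit_of_repaired Ec E' P hPc hPcd hEan hE4 hbddPK hoff hon
  have hEbd' := locallyBounded_slit_of_repaired Ec E' P hPc hPcd hEan hEbd hbddPK hoff hon
  -- the middle coefficient `ψ_z(g) := ((Ec♯ z)_B(g) − φ(g)H^z) ∕ H^{2−z}`: holomorphic on the slit plane, `= Ag·c_S` on the tube, hence `= qc·(Ag∕A)` near `3∕2`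
  have hψa := differentiableOn_middleCoefficient_slitPlane_cm_three L E' ({((3 : ℂ) / 2)} : Finset ℂ) hEd hE4' hEbd' ν h𝓕N h𝓕c φ
    (fun z g => (borelConstantTerm ν 𝓕 (E' z) g - φ g * (((borelHeight g : ℝ≥0) : ℝ) : ℂ) ^ z) / (((borelHeight g : ℝ≥0) : ℝ) : ℂ) ^ (2 - z)) (fun z _ g => rfl)
  have hψ2' : ∀ z : ℂ, 2 < z.re → ∀ g : (quasiSplit (↥(maximalRealSubfield L)) L (IsCMField.complexConj L) 3).Adelic,
      (fun z g => (borelConstantTerm ν 𝓕 (E' z) g - φ g * (((borelHeight g : ℝ≥0) : ℝ) : ℂ) ^ z) / (((borelHeight g : ℝ≥0) : ℝ) : ℂ) ^ (2 - z)) z g = Ag g z *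
        ((partialStandardL S (fun w => {(ξ.bcη⁻¹ * μω).valueAtUniformizer w}) (z - 1) * partialStandardL T' (fun v => {(1 : HeckeCharacter ↥(maximalRealSubfield L)).valueAtUniformizer v}) (2 * z - 2)) /
            (partialStandardL S (fun w => {(ξ.bcη⁻¹ * μω).valueAtUniformizer w}) z * partialStandardL T' (fun v => {(1 : HeckeCharacter ↥(maximalRealSubfield L)).valueAtUniformizer v}) (2 * z - 1))) := fun z hz g => by
    show (borelConstantTerm ν 𝓕 (E' z) g - φ g * (((borelHeight g : ℝ≥0) : ℝ) : ℂ) ^ z) / (((borelHeight g : ℝ≥0) : ℝ) : ℂ) ^ (2 - z) = _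
    rw [hE2' z hz]
    exact hψ2 z hz g
  have hfac := eventually_factorisation_of_unfolded
    (fun z g => (borelConstantTerm ν 𝓕 (E' z) g - φ g * (((borelHeight g : ℝ≥0) : ℝ) : ℂ) ^ z) / (((borelHeight g : ℝ≥0) : ℝ) : ℂ) ^ (2 - z)) q qc hqcq hPqcd hqa A hA hA32 _ hsrc
    Ag hAg hψ2' ({((3 : ℂ) / 2)} : Finset ℂ) hψa
  -- the domain `D`: an open piece of the punctured neighbourhood where the factorisation holds, inside `{1 < Re} ∩ Pᶜ ∖ {3∕2}`
  have hO : IsOpen {z : ℂ | 1 < z.re} := isOpen_lt continuous_const Complex.continuous_re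
  have hmem : ((3 : ℂ) / 2) ∈ {z : ℂ | 1 < z.re} := by
    show (1 : ℝ) < (((3 : ℂ) / 2)).re
    norm_num
  obtain ⟨O, hOfac, hOo, hO32⟩ := _root_.mem_nhds_iff.1 (eventually_nhdsWithin_iff.1 hfac)
  have hDo : IsOpen (((O ∩ {z : ℂ | 1 < z.re}) ∩ Pᶜ) \ {((3 : ℂ) / 2)}) := ((hOo.inter hO).inter hPc.isOpen_compl).sdiff isClosed_singleton
  have hD : ∀ᶠ z in 𝓝[≠] ((3 : ℂ) / 2), z ∈ ((O ∩ {z : ℂ | 1 < z.re}) ∩ Pᶜ) \ {((3 : ℂ) / 2)} := by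
    filter_upwards [mem_nhdsWithin_of_mem_nhds (hOo.mem_nhds hO32), mem_nhdsWithin_of_mem_nhds (hO.mem_nhds hmem), hPcd ((3 : ℂ) / 2), self_mem_nhdsWithin] with z h1 h2 h3 h4
    exact ⟨⟨⟨h1, h2⟩, h3⟩, h4⟩
  have hDsub : ((O ∩ {z : ℂ | 1 < z.re}) ∩ Pᶜ) \ {((3 : ℂ) / 2)} ⊆ ({z : ℂ | 1 < z.re} \ (↑({(3 : ℂ) / 2} : Finset ℂ) : Set ℂ)) := fun z hz =>
    ⟨hz.1.1.2, by rw [Finset.coe_singleton]; exact hz.2⟩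
  have hDP : ((O ∩ {z : ℂ | 1 < z.re}) ∩ Pᶜ) \ {((3 : ℂ) / 2)} ⊆ Pᶜ := fun z hz => hz.1.2
  -- the continued constant-term identity on `D` (there `Ec♯ = Ec`), with `ψ := qc·(Ag∕A)`
  have hE3 : ∀ z ∈ ((O ∩ {z : ℂ | 1 < z.re}) ∩ Pᶜ) \ {((3 : ℂ) / 2)}, ∀ g : (quasiSplit (↥(maximalRealSubfield L)) L (IsCMField.complexConj L) 3).Adelic,
      borelConstantTerm ν 𝓕 (Ec z) g = φ g * (((borelHeight g : ℝ≥0) : ℝ) : ℂ) ^ z + (fun z g => qc z * (Ag g z / A z)) z g * (((borelHeight g : ℝ≥0) : ℝ) : ℂ) ^ (2 - z) := by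
    intro z hz g
    have hzfac := hOfac (hz.1.1.1) hz.2 g
    have hEz : E' z g = Ec z g := hoff z g fun h => hz.1.2 h.1
    have hEz' : E' z = Ec z := funext fun g' => hoff z g' fun h => hz.1.2 h.1
    show borelConstantTerm ν 𝓕 (Ec z) g = φ g * (((borelHeight g : ℝ≥0) : ℝ) : ℂ) ^ z + qc z * (Ag g z / A z) * (((borelHeight g : ℝ≥0) : ℝ) : ℂ) ^ (2 - z)
    have h : (borelConstantTerm ν 𝓕 (E' z) g - φ g * (((borelHeight g : ℝ≥0) : ℝ) : ℂ) ^ z) / (((borelHeight g : ℝ≥0) : ℝ) : ℂ) ^ (2 - z) = qc z * (Ag g z / A z) := hzfac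
    rw [hEz'] at h
    rw [← h, div_mul_cancel₀ _ (hpow g (2 - z)), add_sub_cancel]
  -- `φt := Ag ∕ A`: continuity at `3∕2`, the non-vanishing base point, the uniform bound
  have hφt : ∀ g : (quasiSplit (↥(maximalRealSubfield L)) L (IsCMField.complexConj L) 3).Adelic, ContinuousAt (fun z => (fun z g => Ag g z / A z) z g) ((3 : ℂ) / 2) := fun g =>
    (((hAg g).differentiableAt (hO.mem_nhds hmem)).continuousAt).div ((hA.differentiableAt (hO.mem_nhds hmem)).continuousAt) hA32
  have hg₀' : (fun z g => Ag g z / A z) ((3 : ℂ) / 2) g₀ ≠ 0 := div_ne_zero hg₀ hA32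
  have hφtbd : ∀ g : (quasiSplit (↥(maximalRealSubfield L)) L (IsCMField.complexConj L) 3).Adelic, ‖(fun z g => Ag g z / A z) ((3 : ℂ) / 2) g‖ ≤ M / ‖A ((3 : ℂ) / 2)‖ := fun g => by
    show ‖Ag g ((3 : ℂ) / 2) / A ((3 : ℂ) / 2)‖ ≤ M / ‖A ((3 : ℂ) / 2)‖
    rw [norm_div]
    exact div_le_div_of_nonneg_right (hM g) (norm_nonneg _)
  exact resGMidBlock_ne_bot_of_tauGenerator_rows L μ μω hμu hμω ξ U₀ φ hφ hφc Ec P hPc hPcd hPre hEcE hEan hE4 hEbd hbddPK hbdd32 ν h𝓕N h𝓕c hDo hD hDsub hDP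
    (fun z g => qc z * (Ag g z / A z)) (fun z g => Ag g z / A z) hE3 q qc hqcq hPqcd hqa (Eventually.of_forall fun z g => rfl) hφt hg₀' hφtbd hS hurφ hT' hurη A hA hsrc hA32
    hT Fam (hFd.mono hDP) (fun z hz => hFam z (hDP hz)) hMS hL

/-! ## §2 HEAD — (V-τ) ED. 3 -/

/-- **HEAD — `resGMidBlock_ne_bot_of_tauGenerator_letters_v3` ((V-τ), ED. 3): `LHalfNeZero (ξ.bcη⁻¹·μω) → resGMidBlock L μ ξ μω ≠ ⊥` from a τ-admissible witness** — the exports ★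
(★ p865131 ∘ ★ p864934), the Maass–Selberg letter ★ (★ ED. 2 §1), row (ii) from the unfolding profile (§1); visible: `hPL`, the (iii) scalar block of record, the unfolding profile (ii′),
the Maass–Selberg frame extras and (R)′τ V3's letters `hunfK hPreal hreal`. [cite: Rogawski1990, §13.9 (ii) p. 229] [cite: MoeglinWaldspurger1995, II.1.7, IV.1.11, V.3.13]
[cite: BernsteinLapid2019, Thm 2.3, §4] -/
theorem resGMidBlock_ne_bot_of_tauGenerator_letters_v3
    (μ : Measure (quasiSplit (↥(maximalRealSubfield L)) L (IsCMField.complexConj L) 3).automorphicQuotient) [(quasiSplit (↥(maximalRealSubfield L)) L (IsCMField.complexConj L) 3).IsAutomorphicMeasure μ]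
    (μω : HeckeCharacter L) (hμu : μω.IsUnitary)
    (hμω : ∀ x : ideleGroup ↥(maximalRealSubfield L), μω (AdeleRing.ideleBaseChange (↥(maximalRealSubfield L)) L x) = quadraticHeckeCharCM L x)
    (ξ : OneDimAutRepH L)
    -- the exports' frame (F)(F′) of ★ p865131 (Haar measure on `G(𝔸)`, covering weight, quotient measure, the ports' auxiliary Haar measures)
    (νG : Measure (quasiSplit (↥(maximalRealSubfield L)) L (IsCMField.complexConj L) 3).Adelic) [νG.IsHaarMeasure] [νG.IsInvInvariant] [SFinite νG]
    {β : (quasiSplit (↥(maximalRealSubfield L)) L (IsCMField.complexConj L) 3).Adelic → ℝ≥0∞}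
    (hβ : IsCoveringWeight ↥((arithmeticBorel (↥(maximalRealSubfield L)) L (IsCMField.complexConj L) 3).map (quasiSplit (↥(maximalRealSubfield L)) L (IsCMField.complexConj L) 3).arithmeticSubgroup.subtype) β)
    {μZ : Measure (borelQuotient (↥(maximalRealSubfield L)) L (IsCMField.complexConj L) 3)} [SFinite μZ]
    (hμZ : ∀ f : borelQuotient (↥(maximalRealSubfield L)) L (IsCMField.complexConj L) 3 → ℝ≥0∞, Measurable f → ∫⁻ z, f z ∂μZ = ∫⁻ g, β g * f (toBorelQuotient (↥(maximalRealSubfield L)) L (IsCMField.complexConj L) 3 g) ∂νG)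
    (μa : Measure (arch (↥(maximalRealSubfield L)) L (IsCMField.complexConj L) 3 ((StdForm.antidiagonal 3).over L))) [μa.IsHaarMeasure] [μa.IsMulRightInvariant]
    (μf : Measure (finAdelic (↥(maximalRealSubfield L)) L (IsCMField.complexConj L) 3 ((StdForm.antidiagonal 3).over L))) [μf.IsHaarMeasure]
    -- (i) THE τ-ADMISSIBLE WITNESS AS DATA: a τ-level `U₀`, a continuous `K_∞`-finite pair-section of level `(ι_f U₀, 1)` (e.g. the shifted pure tensor `Φ^{p,q}_∞ ⊗ Φ_f`)
    (U₀ : Subgroup ↥(finAdelic (↥(maximalRealSubfield L)) L (IsCMField.complexConj L) 3 ((StdForm.antidiagonal 3).over L))) (hU₀ : IsTauLevel L U₀)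
    (φ : (quasiSplit (↥(maximalRealSubfield L)) L (IsCMField.complexConj L) 3).Adelic → ℂ) (hφ : φ ∈ chiSectionSpacePair (ξ.bcη⁻¹ * ξ.bcψ⁻¹ * μω) ξ.ψ (tauLevel L U₀) ((1 : ↥(tauLevel L U₀) →* ℂ) : ↥(tauLevel L U₀) → ℂ)) (hφc : Continuous φ) (hφa : IsArchFinite L φ)
    -- the NORMALISED Heisenberg package of ★ p865131's row (Haar, inversion-invariant, `ν 𝓕 = 1`)
    (ν : Measure ↥(adelicUnipotent (↥(maximalRealSubfield L)) L (IsCMField.complexConj L) 3)) [ν.IsHaarMeasure] [ν.IsInvInvariant]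
    {𝓕 : Set ↥(adelicUnipotent (↥(maximalRealSubfield L)) L (IsCMField.complexConj L) 3)}
    (h𝓕N : IsFundamentalDomain ↥(rationalUnipotent (↥(maximalRealSubfield L)) L (IsCMField.complexConj L) 3) 𝓕 ν) (h𝓕c : IsCompact (closure 𝓕)) (h𝓕1 : ν 𝓕 = 1)
    -- (i) LETTER — THE POLE LEDGER over the exported continuation (estate T's `hPL` clause shape; payers: τ-MS32 ★ p865152, the off-axis machinery of (R)′τ V3)
    (hPL : ∀ (Ec : ℂ → (quasiSplit (↥(maximalRealSubfield L)) L (IsCMField.complexConj L) 3).Adelic → ℂ) (P : Set ℂ), (∀ z : ℂ, 2 < z.re → Ec z = eisensteinSeriesU (flatSectionU φ z)) →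
      (∀ z₀ : ℂ, ∀ᶠ s in 𝓝[≠] z₀, s ∉ P) → (∀ g (z : ℂ), z ∉ P → AnalyticAt ℂ (fun z => Ec z g) z) →
      (∀ z₀ ∈ P, 1 < z₀.re → z₀ ≠ ((3 : ℂ) / 2) → ∀ K : Set (quasiSplit (↥(maximalRealSubfield L)) L (IsCMField.complexConj L) 3).Adelic, IsCompact K → ∃ C : ℝ, ∀ᶠ z in 𝓝[≠] z₀, ∀ g ∈ K, ‖Ec z g‖ ≤ C) ∧
      (∀ g, ∃ C : ℝ, ∀ᶠ z in 𝓝[≠] ((3 : ℂ) / 2), ‖(z - ((3 : ℂ) / 2)) * Ec z g‖ ≤ C))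
    -- (iii) THE SCALAR BLOCK OF RECORD (shared with the (V-1) column, as in (R)′τ V3): the continued scalar `qc` off its co-discrete `Pq`, the F5 ramification sets and the base amplitude `A` with `q = A·c_S`, `A(3∕2) ≠ 0`
    (q qc : ℂ → ℂ) {Pq : Set ℂ} (hqcq : ∀ z : ℂ, 2 < z.re → qc z = q z) (hPqcd : ∀ z₀ : ℂ, ∀ᶠ s in 𝓝[≠] z₀, s ∉ Pq) (hqa : ∀ z : ℂ, z ∉ Pq → AnalyticAt ℂ qc z)
    {S : Set (HeightOneSpectrum (𝓞 L))} {T' : Set (HeightOneSpectrum (𝓞 ↥(maximalRealSubfield L)))}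
    (hS : S.Finite) (hurφ : ∀ w ∉ S, (ξ.bcη⁻¹ * μω).IsUnramifiedAt w) (hT' : T'.Finite) (hurη : ∀ v ∉ T', (1 : HeckeCharacter ↥(maximalRealSubfield L)).IsUnramifiedAt v)
    (A : ℂ → ℂ) (hA : DifferentiableOn ℂ A {z : ℂ | 1 < z.re})
    (hsrc : ∀ z : ℂ, 2 < z.re → q z = A z *
          ((partialStandardL S (fun w => {(ξ.bcη⁻¹ * μω).valueAtUniformizer w}) (z - 1) * partialStandardL T' (fun v => {(1 : HeckeCharacter ↥(maximalRealSubfield L)).valueAtUniformizer v}) (2 * z - 2)) /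
            (partialStandardL S (fun w => {(ξ.bcη⁻¹ * μω).valueAtUniformizer w}) z * partialStandardL T' (fun v => {(1 : HeckeCharacter ↥(maximalRealSubfield L)).valueAtUniformizer v}) (2 * z - 1))))
    (hA32 : A (3 / 2) ≠ 0)
    -- (ii′) THE WITNESS'S Ec-FREE UNFOLDING PROFILE (payer for the shifted pure tensor: ★ p865072 ∘ ★ p864998 §2 ∘ ★ p865311 on `K_max` + Iwasawa transport; ★ `hA32_shifted_of_record_at_basePoint_of_modEq` for `hg₀`)
    (Ag : (quasiSplit (↥(maximalRealSubfield L)) L (IsCMField.complexConj L) 3).Adelic → ℂ → ℂ) (hAg : ∀ g, DifferentiableOn ℂ (Ag g) {z : ℂ | 1 < z.re}) {M : ℝ} (hM : ∀ g, ‖Ag g ((3 : ℂ) / 2)‖ ≤ M)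
    (hψ2 : ∀ z : ℂ, 2 < z.re → ∀ g : (quasiSplit (↥(maximalRealSubfield L)) L (IsCMField.complexConj L) 3).Adelic,
      (borelConstantTerm ν 𝓕 (eisensteinSeriesU (flatSectionU φ z)) g - φ g * (((borelHeight g : ℝ≥0) : ℝ) : ℂ) ^ z) / (((borelHeight g : ℝ≥0) : ℝ) : ℂ) ^ (2 - z) = Ag g z *
        ((partialStandardL S (fun w => {(ξ.bcη⁻¹ * μω).valueAtUniformizer w}) (z - 1) * partialStandardL T' (fun v => {(1 : HeckeCharacter ↥(maximalRealSubfield L)).valueAtUniformizer v}) (2 * z - 2)) /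
            (partialStandardL S (fun w => {(ξ.bcη⁻¹ * μω).valueAtUniformizer w}) z * partialStandardL T' (fun v => {(1 : HeckeCharacter ↥(maximalRealSubfield L)).valueAtUniformizer v}) (2 * z - 1))))
    {g₀ : (quasiSplit (↥(maximalRealSubfield L)) L (IsCMField.complexConj L) 3).Adelic} (hg₀ : Ag g₀ ((3 : ℂ) / 2) ≠ 0)
    -- the Maass–Selberg frame extras of ★ p865152 (Haar measure on `K_max`, Haar measure on the ideles, an idele-class domain)
    (μK : Measure ↥((standardMaximalCompactGL 3 L).comap (adelicVal (↥(maximalRealSubfield L)) L (IsCMField.complexConj L) 3 ((StdForm.antidiagonal 3).over L)) : Subgroup (quasiSplit (↥(maximalRealSubfield L)) L (IsCMField.complexConj L) 3).Adelic)) [μK.IsHaarMeasure]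
    (νI : Measure (AdeleRing (𝓞 L) L)ˣ) [νI.IsHaarMeasure] {𝓕I : Set (AdeleRing (𝓞 L) L)ˣ} (h𝓕I : IsIdeleClassDomain L 𝓕I)
    -- PER τ-ADMISSIBLE SECTION — (R)′τ V3's letters VERBATIM (★ p865313 :117–:143)
    (hunfK :
      ∀ (U₀ : Subgroup ↥(finAdelic (↥(maximalRealSubfield L)) L (IsCMField.complexConj L) 3 ((StdForm.antidiagonal 3).over L))) (_ : IsTauLevel L U₀)
      (φ : (quasiSplit (↥(maximalRealSubfield L)) L (IsCMField.complexConj L) 3).Adelic → ℂ) (_ : φ ∈ chiSectionSpacePair (ξ.bcη⁻¹ * ξ.bcψ⁻¹ * μω) ξ.ψ (tauLevel L U₀) ((1 : ↥(tauLevel L U₀) →* ℂ) : ↥(tauLevel L U₀) → ℂ)) (_ : Continuous φ)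
      (_ : IsArchFinite L φ)
      (ν : Measure ↥(adelicUnipotent (↥(maximalRealSubfield L)) L (IsCMField.complexConj L) 3)) (_ : ν.IsHaarMeasure) (𝓕 : Set ↥(adelicUnipotent (↥(maximalRealSubfield L)) L (IsCMField.complexConj L) 3)) (_ : IsFundamentalDomain ↥(rationalUnipotent (↥(maximalRealSubfield L)) L (IsCMField.complexConj L) 3) 𝓕 ν) (_ : IsCompact (closure 𝓕)) (_ : ν.IsInvInvariant) (_ : ν 𝓕 = 1),
      ∀ k : (quasiSplit (↥(maximalRealSubfield L)) L (IsCMField.complexConj L) 3).Adelic, adelicVal (↥(maximalRealSubfield L)) L (IsCMField.complexConj L) 3 ((StdForm.antidiagonal 3).over L) k ∈ standardMaximalCompactGL 3 L →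
        ∃ A' : ℂ → ℂ, DifferentiableOn ℂ A' {z : ℂ | 1 < z.re} ∧ ∀ z : ℂ, 2 < z.re →
          (∫ v : ↥(adelicUnipotent (↥(maximalRealSubfield L)) L (IsCMField.complexConj L) 3), flatSectionU φ z ((quasiSplit (↥(maximalRealSubfield L)) L (IsCMField.complexConj L) 3).toAdelic (weylLongU ((IsCMField.complexConj L : L ≃ₐ[↥(maximalRealSubfield L)] L) : L →+* L) (rfl : (StdForm.antidiagonal 3).over L = (StdForm.antidiagonal 3).over L)) * ((v : (quasiSplit (↥(maximalRealSubfield L)) L (IsCMField.complexConj L) 3).Adelic) * k)) ∂ν) =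
            ((partialStandardL S (fun w => {(ξ.bcη⁻¹ * μω).valueAtUniformizer w}) (z - 1) * partialStandardL T' (fun v => {(1 : HeckeCharacter ↥(maximalRealSubfield L)).valueAtUniformizer v}) (2 * z - 2)) / (partialStandardL S (fun w => {(ξ.bcη⁻¹ * μω).valueAtUniformizer w}) z * partialStandardL T' (fun v => {(1 : HeckeCharacter ↥(maximalRealSubfield L)).valueAtUniformizer v}) (2 * z - 1))) * A' z)
    (hPreal :
      ∀ (U₀ : Subgroup ↥(finAdelic (↥(maximalRealSubfield L)) L (IsCMField.complexConj L) 3 ((StdForm.antidiagonal 3).over L))) (_ : IsTauLevel L U₀)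
      (φ : (quasiSplit (↥(maximalRealSubfield L)) L (IsCMField.complexConj L) 3).Adelic → ℂ) (_ : φ ∈ chiSectionSpacePair (ξ.bcη⁻¹ * ξ.bcψ⁻¹ * μω) ξ.ψ (tauLevel L U₀) ((1 : ↥(tauLevel L U₀) →* ℂ) : ↥(tauLevel L U₀) → ℂ)) (_ : Continuous φ)
      (_ : IsArchFinite L φ)
      (ν : Measure ↥(adelicUnipotent (↥(maximalRealSubfield L)) L (IsCMField.complexConj L) 3)) (_ : ν.IsHaarMeasure) (𝓕 : Set ↥(adelicUnipotent (↥(maximalRealSubfield L)) L (IsCMField.complexConj L) 3)) (_ : IsFundamentalDomain ↥(rationalUnipotent (↥(maximalRealSubfield L)) L (IsCMField.complexConj L) 3) 𝓕 ν) (_ : IsCompact (closure 𝓕)) (_ : ν.IsInvInvariant) (_ : ν 𝓕 = 1),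
      ∀ (ι : Type) [Fintype ι] (φ' : ι → (quasiSplit (↥(maximalRealSubfield L)) L (IsCMField.complexConj L) 3).Adelic → ℂ) (qv qcv : ι → ℂ → ℂ) (Pv : Set ℂ),
        LinearIndependent ℂ φ' →
        (∀ j, IsChiSectionPair (reflectChar (IsCMField.complexConj L) (ξ.bcη⁻¹ * ξ.bcψ⁻¹ * μω)) ξ.ψ (φ' j)) →
        (∀ j, Continuous (φ' j)) →
        (∀ j, ∃ C : ℝ, ∀ x, ‖φ' j x‖ ≤ C) →
        (∀ z : ℂ, 2 < z.re → (∑ j, qv j z • φ' j) = ((((ν 𝓕).toReal⁻¹ : ℝ)) : ℂ) • (fun g : (quasiSplit (↥(maximalRealSubfield L)) L (IsCMField.complexConj L) 3).Adelic => (∫ v : ↥(adelicUnipotent (↥(maximalRealSubfield L)) L (IsCMField.complexConj L) 3), flatSectionU φ z ((quasiSplit (↥(maximalRealSubfield L)) L (IsCMField.complexConj L) 3).toAdelic (weylLongU ((IsCMField.complexConj L : L ≃ₐ[↥(maximalRealSubfield L)] L) : L →+* L) (rfl : (StdForm.antidiagonal 3).over L = (StdForm.antidiagonal 3).over L)) *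 ((v : (quasiSplit (↥(maximalRealSubfield L)) L (IsCMField.complexConj L) 3).Adelic) * g)) ∂ν) * (((borelHeight g : ℝ) : ℂ) ^ (z - 2)))) →
        (∀ z₀ : ℂ, ∀ᶠ s in 𝓝[≠] z₀, s ∉ Pv) →
        (∀ z ∈ Pv, z.re ≤ 2) →
        (∀ j (z : ℂ), z ∉ Pv → AnalyticAt ℂ (qcv j) z) →
        (∀ j (z : ℂ), 2 < z.re → qcv j z = qv j z) →
        (∀ j, MeromorphicNFOn (qcv j) univ) →
      ∀ j (z : ℂ), 1 < z.re → z.im ≠ 0 → AnalyticAt ℂ (qcv j) z)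
    -- PER τ-GENERATOR — (R)′τ V3's axis-reality letter VERBATIM (:145–:161)
    (hreal :
      ∀ (U₀ : Subgroup ↥(finAdelic (↥(maximalRealSubfield L)) L (IsCMField.complexConj L) 3 ((StdForm.antidiagonal 3).over L))) (_ : IsTauLevel L U₀)
      (φ : (quasiSplit (↥(maximalRealSubfield L)) L (IsCMField.complexConj L) 3).Adelic → ℂ) (_ : φ ∈ chiSectionSpacePair (ξ.bcη⁻¹ * ξ.bcψ⁻¹ * μω) ξ.ψ (tauLevel L U₀) ((1 : ↥(tauLevel L U₀) →* ℂ) : ↥(tauLevel L U₀) → ℂ)) (_ : Continuous φ)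
      (_ : IsArchFinite L φ)
      (ν : Measure ↥(adelicUnipotent (↥(maximalRealSubfield L)) L (IsCMField.complexConj L) 3)) (_ : ν.IsHaarMeasure) (𝓕 : Set ↥(adelicUnipotent (↥(maximalRealSubfield L)) L (IsCMField.complexConj L) 3)) (_ : IsFundamentalDomain ↥(rationalUnipotent (↥(maximalRealSubfield L)) L (IsCMField.complexConj L) 3) 𝓕 ν) (_ : IsCompact (closure 𝓕)) (_ : ν.IsInvInvariant) (_ : ν 𝓕 = 1),
      ∀ (ι : Type) [Fintype ι] (φ' : ι → (quasiSplit (↥(maximalRealSubfield L)) L (IsCMField.complexConj L) 3).Adelic → ℂ) (qv qcv : ι → ℂ → ℂ) (Pv : Set ℂ),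
        (∀ j, IsChiSectionPair (reflectChar (IsCMField.complexConj L) (ξ.bcη⁻¹ * ξ.bcψ⁻¹ * μω)) ξ.ψ (φ' j)) →
        (∀ j, Continuous (φ' j)) →
        (∀ j, ∃ C : ℝ, ∀ x, ‖φ' j x‖ ≤ C) →
        (∀ z : ℂ, 2 < z.re → (∑ j, qv j z • φ' j) = ((((ν 𝓕).toReal⁻¹ : ℝ)) : ℂ) • (fun g : (quasiSplit (↥(maximalRealSubfield L)) L (IsCMField.complexConj L) 3).Adelic => (∫ v : ↥(adelicUnipotent (↥(maximalRealSubfield L)) L (IsCMField.complexConj L) 3), flatSectionU φ z ((quasiSplit (↥(maximalRealSubfield L)) L (IsCMField.complexConj L) 3).toAdelic (weylLongU ((IsCMField.complexConj L : L ≃ₐ[↥(maximalRealSubfield L)] L) : L →+* L) (rfl : (StdForm.antidiagonal 3).over L = (StdForm.antidiagonal 3).over L)) * ((v : (quasiSplit (↥(maximalRealSubfield L)) L (IsCMField.complexConj L) 3).Adelic) * g)) ∂ν) * (((borelHeight g : ℝ) : ℂ) ^ (z - 2)))) →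
        (∀ z₀ : ℂ, ∀ᶠ s in 𝓝[≠] z₀, s ∉ Pv) →
        (∀ z ∈ Pv, z.re ≤ 2) →
        (∀ j (z : ℂ), z ∉ Pv → AnalyticAt ℂ (qcv j) z) →
        (∀ j (z : ℂ), 2 < z.re → qcv j z = qv j z) →
        (∀ j, MeromorphicNFOn (qcv j) univ) →
      (∀ (μK : Measure ↥((standardMaximalCompactGL 3 L).comap (adelicVal (↥(maximalRealSubfield L)) L (IsCMField.complexConj L) 3 ((StdForm.antidiagonal 3).over L)) : Subgroup (quasiSplit (↥(maximalRealSubfield L)) L (IsCMField.complexConj L) 3).Adelic)) (_ : μK.IsHaarMeasure) (νI : Measure (AdeleRing (𝓞 L) L)ˣ) (_ : νI.IsHaarMeasure) (𝓕I : Set (AdeleRing (𝓞 L) L)ˣ) (_ : IsIdeleClassDomain L 𝓕I) (wc : ℂ → ℂ),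
          (∀ z : ℂ, wc z = (∑ j, qcv j z * ∫ k, φ' j (k : (quasiSplit (↥(maximalRealSubfield L)) L (IsCMField.complexConj L) 3).Adelic) * conj (φ (k : (quasiSplit (↥(maximalRealSubfield L)) L (IsCMField.complexConj L) 3).Adelic)) ∂μK) * ∫ x in {x : (AdeleRing (𝓞 L) L)ˣ | (IdeleClassGroup.ideleNorm L x : ℝ) ≤ 1} ∩ 𝓕I, ((IdeleClassGroup.ideleNorm L x : ℝ) : ℂ) * (((reflectChar (IsCMField.complexConj L) (ξ.bcη⁻¹ * ξ.bcψ⁻¹ * μω) x : ℂˣ) : ℂ) * conj (((ξ.bcη⁻¹ * ξ.bcψ⁻¹ * μω) x : ℂˣ) : ℂ)) ∂νI) → ∀ᶠ x : ℝ in 𝓝[≠] (3 / 2 : ℝ), (wc (x : ℂ)).im = 0)) :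
    LHalfNeZero (ξ.bcη⁻¹ * μω) → resGMidBlock L μ ξ μω ≠ ⊥ := by
  intro hL
  -- ★ p865131 ∘ ★ p864934: the K-finite exports with the truncated family at the witness and the package; the ledger and the Maass–Selberg bound (★ ED. 2 §1) at them
  obtain ⟨Ec, P, hPc, hPcd, hPre, hEcE, hEan, hE4, hEbd, hE6⟩ :=
    hTEXP6_row_of_ports L μ νG hβ hμZ μa μf ξ μω hμu (hCO_of_transposeRealisations L ξ μω hμu) U₀ hU₀ φ hφ hφc hφa ν inferInstance 𝓕 h𝓕N h𝓕c inferInstance h𝓕1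
  obtain ⟨Fam, hFd, hFam⟩ := hE6 1 le_rfl
  obtain ⟨hbddPK, hbdd32⟩ := hPL Ec P hEcE hPcd hEan
  have hMS := hMS_tauWitness_of_columnLetters L μ μω hμu hμω ξ νG hβ hμZ μa μf U₀ hU₀ φ hφ hφc hφa ν h𝓕N h𝓕c h𝓕1 q qc hqcq hPqcd hqa hS hurφ hT' hurη A hA hsrc hA32
    μK νI h𝓕I hunfK hPreal hreal Ec P Fam hEcE hPcd hEan hFd hFam
  exact resGMidBlock_ne_bot_of_tauGenerator_rows_v2 L μ μω hμu hμω ξ U₀ φ hφ hφc Ec P hPc hPcd hPre hEcE hEan hE4 hEbd hbddPK hbdd32 ν h𝓕N h𝓕c q qc hqcq hPqcd hqa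
    hS hurφ hT' hurη A hA hsrc hA32 Ag hAg hM hψ2 hg₀ le_rfl Fam hFd hFam hMS hL

end Summit.HodgeConjecture.HodgeConjecture.R90.S8

end
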